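import Mathlib
import Literature.Computability.Complexity.RandomKSatEnsembleOGP
import Summits.PneNP.PneNP.Theorems.OverlapGapAlgebraSearchHardWindowChainMassBasic

/-!
# Route OverlapGapAlgebra, crux `SearchHardWindow` (stmt-PneNP-2460): union bound for the chain mass

For the `ε`-resampling Markov chain on a finite product space `ι → Γ` (Huang–Sellke 2025 §3.3.2;
vocabulary `resampleKernel`, `resampleChainMass` of
`Literature/Computability/Complexity/RandomKSatEnsembleOGP.lean`) the mass of an event `E` on paths
is the finite weighted count
`resampleChainMass ε K E = (Σ_y (∏_{t<K} P_ε(y t, y (t+1))) · [E (t ↦ y (min t K))]) / #(ι → Γ)`,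
the sum ranging over `y : Fin (K+1) → ι → Γ`.

`stub_chainMassUnion` is the finite union bound `mass(∃ x, E x) ≤ Σ_x mass(E x)` over a finite index
type `X`, used by the first-moment step (the CHAOS lemma, Huang–Sellke 2025 Lemma 3.23) of line
`Sketch`: after pulling the division and the sum over `x` through (`Finset.sum_div`,
`Finset.sum_comm`, `Finset.mul_sum`) it is, for each path `y`, the indicator inequality
`[∃ x, E x z] ≤ Σ_x [E x z]` (a witness contributes a term `1` to a sum of nonnegative terms)
multiplied by the nonnegative path weight (`cmb_pathWeight_nonneg` of
`Theorems/OverlapGapAlgebraSearchHardWindowChainMassBasic.lean`, valid for `0 ≤ ε ≤ 1`).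
-/

set_option linter.dupNamespace false -- `Summit.PneNP.PneNP.…`: summit = sub-problem

namespace Summit.PneNP.PneNP.Theorems

open Finset
open Literature.Computability.Complexity
open scoped Classical

/-- Indicator union bound over a finite type: `[∃ x, p x] ≤ Σ_x [p x]` (any `Decidable`
instances). If the `∃` holds with witness `x₀`, the right-hand sum of nonnegative indicators is at
least its `x₀` term `1`; otherwise the left side is `0`. -/
theorem cmu_ite_exists_le_sum {X : Type*} [Fintype X] {p : X → Prop} {hp : ∀ x, Decidable (p x)}
    {hex : Decidable (∃ x, p x)} :
    @ite ℝ (∃ x, p x) hex 1 0 ≤ ∑ x, @ite ℝ (p x) (hp x) 1 0 := by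
  have hnn : ∀ x ∈ (Finset.univ : Finset X), (0 : ℝ) ≤ @ite ℝ (p x) (hp x) 1 0 := fun x _ => by
    split_ifs <;> norm_num
  by_cases h : ∃ x, p x
  · obtain ⟨x₀, hx₀⟩ := h
    rw [if_pos ⟨x₀, hx₀⟩]
    calc (1 : ℝ) = @ite ℝ (p x₀) (hp x₀) 1 0 := by rw [if_pos hx₀]
      _ ≤ ∑ x, @ite ℝ (p x) (hp x) 1 0 :=
        Finset.single_le_sum (f := fun x => @ite ℝ (p x) (hp x) 1 0) hnn (Finset.mem_univ x₀)
  · rw [if_neg h]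
    exact Finset.sum_nonneg hnn

/-- **Union bound for the chain mass** of the `ε`-resampling chain (`0 ≤ ε ≤ 1`): over a finite
index type `X`, `resampleChainMass ε K (∃ x, E x ·) ≤ Σ_x resampleChainMass ε K (E x)`. The path
weights `∏_{t<K} P_ε(y t, y (t+1))` are nonnegative, so the bound is the pathwise indicator
inequality `[∃ x, E x z] ≤ Σ_x [E x z]` summed against them. -/
theorem stub_chainMassUnion {ι Γ X : Type*} [Fintype ι] [DecidableEq ι] [Fintype Γ] [DecidableEq Γ]
    [Nonempty Γ] [Fintype X] (ε : ℝ) (hε0 : 0 ≤ ε) (hε1 : ε ≤ 1) (K : ℕ)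
    (E : X → (ℕ → ι → Γ) → Prop) :
    resampleChainMass ε K (fun z => ∃ x, E x z) ≤ ∑ x, resampleChainMass ε K (E x) := by
  unfold resampleChainMass
  rw [← Finset.sum_div]
  refine div_le_div_of_nonneg_right ?_ (Nat.cast_nonneg _)
  rw [Finset.sum_comm]
  refine Finset.sum_le_sum fun y _ => ?_
  rw [← Finset.mul_sum]
  exact mul_le_mul_of_nonneg_left cmu_ite_exists_le_sum (cmb_pathWeight_nonneg ε hε0 hε1 K y)

end Summit.PneNP.PneNP.Theorems
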